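import Literature.Analysis.FluidPDE.NSLerayHopfProofs
import Literature.Analysis.FluidPDE.BackwardUniquenessIterate
import Literature.Analysis.FluidPDE.ESSUniqueContinuationHolds
import Literature.Analysis.FluidPDE.EssCurry
import HarnessLib

/-!
# Backward uniqueness for the heat operator in a half-space (ESS 2003, Thm. 5.1), proved

Analysis/FluidPDE proofs file (theorems only) discharging the named fact
`Literature.Analysis.FluidPDE.ess_backward_uniqueness` of `NSLerayHopfProofs.lean`
(L. Escauriaza, G. Seregin, V. Šverák, Russ. Math. Surveys 58:2 (2003), Thm. 5.1; the printed
proof followed is G. Seregin, *Lecture notes on regularity theory for the Navier–Stokes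
equations*, World Scientific 2014, App. A.3, Thm. 3.5 with Lemmas A.2–A.4, pp. 212–214):
a `C²` function `u` on `Q₊ = ℝⁿ₊ × ]0, 1[` with `|∂ₜu + Δu| ≤ c₁(|∇u| + |u|)`,
`|u(x, t)| ≤ e^{M|x|²}`, `u(·, 0) = 0` (continuously) and the local square integrability (5.4)
vanishes identically.

The proof is assembled from the tree: the two Carleman inequalities (Seregin 2014, Props. 1.2,
1.3: `CarlemanFirst`, `CarlemanSecond`, `CarlemanDensity`), Lemma A.2
(`BackwardUniquenessDecay`), Lemma A.3 (`BackwardUniquenessVanish`, `BackwardUniquenessStrip`,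
with unique continuation across spatial boundaries, Thm. 2.4 =
`Carleman.uniqueContinuation_uncurried` of `ESSUniqueContinuationHolds`), and Lemma A.4 /
Thm. 3.5 (`BackwardUniquenessIterate`). Of the hypothesis (5.4) only the square integrability of
`∂ₜu` on bounded measurable subsets of `Q₊` is used (to control the initial layer, replacing the
source's extension of `u` by zero to `t < 0`, which is not `C²`).

* `ess_backward_uniqueness_holds` — the discharge, through the dictionary of `EssCurry.lean`
  (`∂ₜ = dt`, `Δ = lap`, `‖D(u t)(x)‖ ≤ |∇u|`); `c₁`, `M` are replaced by `max(c₁, 0)`,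
  `max(M, 0)`.

## References

* L. Escauriaza, G. Seregin, V. Šverák, *`L_{3,∞}`-solutions of Navier–Stokes equations and
  backward uniqueness*, Russ. Math. Surveys 58:2 (2003) 211–250, §5, Thm. 5.1.
* G. Seregin, *Lecture notes on regularity theory for the Navier–Stokes equations*, World
  Scientific 2014, App. A.3, Thm. 3.5, Lemmas A.2–A.4, pp. 212–214.
-/

noncomputable section

open MeasureTheory Set Function Filter Metric InnerProductSpace Laplacian
open _root_.Topology
open scoped InnerProductSpace RealInnerProductSpace ENNReal

namespace Literature.Analysis.FluidPDE

/-- **Escauriaza–Seregin–Šverák 2003, Thm. 5.1 (backward uniqueness in a half-space),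
proved**: discharge of the named fact `ess_backward_uniqueness` (`NSLerayHopfProofs.lean`) —
Seregin 2014, App. A.3, Thm. 3.5 for `C²` functions `u : ]0,1[ × ℝⁿ₊ → ℝᵐ`. From
`Carleman.backwardUniqueness_uncurried` (with `Carleman.uniqueContinuation_uncurried` as the
unique continuation input) through the dictionary of `EssCurry.lean`. [cite: EscauriazaSereginSverak2003, Thm. 5.1] [cite: Seregin2014, App. A.3 Thm. 3.5] -/
theorem ess_backward_uniqueness_holds : ess_backward_uniqueness := by
  intro n m e he u c₁ M hC2 hcont hint hineq hgrowth h0 t ht x hx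
  set c : ℝ := max c₁ 0 with hc
  have hc0 : 0 ≤ c := le_max_right _ _
  set M' : ℝ := max M 0 with hM'
  have hM'0 : 0 ≤ M' := le_max_right _ _
  set H : Set (EuclideanSpace ℝ (Fin n)) := {x | 0 < ⟪x, e⟫} with hH
  have hHo : IsOpen H := isOpen_lt continuous_const (continuous_id.inner continuous_const)
  have hopen : IsOpen (Ioo (0 : ℝ) 1 ×ˢ H) := isOpen_Ioo.prod hHo
  -- (A.3.1)
  have hineq' : ∀ z ∈ Ioo (0 : ℝ) 1 ×ˢ H,
      ‖Carleman.dt (uncurry u) z + Carleman.lap (uncurry u) z‖ ≤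
        c * (‖uncurry u z‖ + Real.sqrt (Carleman.gradSq (uncurry u) z)) := by
    rintro ⟨s, y⟩ hz
    have hd : DifferentiableAt ℝ (uncurry u) (s, y) :=
      (hC2.differentiableOn (by norm_num)).differentiableAt (hopen.mem_nhds hz)
    rw [Carleman.dt_uncurry hd, Carleman.lap_uncurry hopen hz hC2]
    have h1 := hineq s hz.1 y hz.2
    have h2 : ‖fderiv ℝ (u s) y‖ ≤ Real.sqrt (Carleman.gradSq (uncurry u) (s, y)) :=
      Carleman.opNorm_fderiv_le_sqrt_gradSq hd
    have h3 : 0 ≤ ‖fderiv ℝ (u s) y‖ + ‖u s y‖ := by positivity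
    calc ‖FluidPDE.timeDeriv u s y + Δ (u s) y‖ ≤ c₁ * (‖fderiv ℝ (u s) y‖ + ‖u s y‖) := h1
      _ ≤ c * (‖fderiv ℝ (u s) y‖ + ‖u s y‖) := mul_le_mul_of_nonneg_right (le_max_left _ _) h3
      _ ≤ c * (Real.sqrt (Carleman.gradSq (uncurry u) (s, y)) + ‖u s y‖) := by gcongr
      _ = c * (‖uncurry u (s, y)‖ + Real.sqrt (Carleman.gradSq (uncurry u) (s, y))) := by
          rw [add_comm]; rfl
  -- (A.3.3)
  have hgrowth' : ∀ z ∈ Ioo (0 : ℝ) 1 ×ˢ H, ‖uncurry u z‖ ≤ Real.exp (M' * ‖z.2‖ ^ 2) := by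
    rintro ⟨s, y⟩ hz
    refine (hgrowth s hz.1 y hz.2).trans (Real.exp_le_exp.2 ?_)
    exact mul_le_mul_of_nonneg_right (le_max_left _ _) (sq_nonneg _)
  -- (A.3.4) for `∂ₜu`
  have hH3 : ∀ K ⊆ Ioo (0 : ℝ) 1 ×ˢ H, Bornology.IsBounded K → MeasurableSet K →
      ∫⁻ z in K, ‖Carleman.dt (uncurry u) z‖ₑ ^ 2 < ∞ := by
    intro K hK hKb hKm
    refine lt_of_le_of_lt (setLIntegral_mono' hKm fun z hz => ?_) (hint K hK hKb hKm)
    have hd : DifferentiableAt ℝ (uncurry u) (z.1, z.2) :=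
      (hC2.differentiableOn (by norm_num)).differentiableAt (hopen.mem_nhds (hK hz))
    have e1 : Carleman.dt (uncurry u) z = FluidPDE.timeDeriv u z.1 z.2 := by
      rw [← Carleman.dt_uncurry hd]
    rw [e1]
    calc ‖FluidPDE.timeDeriv u z.1 z.2‖ₑ ^ 2
        ≤ ‖u z.1 z.2‖ₑ ^ 2 + ‖FluidPDE.timeDeriv u z.1 z.2‖ₑ ^ 2 := le_add_self
      _ ≤ ‖u z.1 z.2‖ₑ ^ 2 + ‖FluidPDE.timeDeriv u z.1 z.2‖ₑ ^ 2 +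
          ‖iteratedFDeriv ℝ 2 (u z.1) z.2‖ₑ ^ 2 := le_self_add
  -- (A.3.2)
  have h0' : ∀ y : EuclideanSpace ℝ (Fin n), 0 < ⟪y, e⟫ → uncurry u (0, y) = 0 := fun y hy => h0 y hy
  have hUC := fun (c' R T : ℝ) (hc' : 0 ≤ c') (hR : 0 < R) (hT : 0 < T)
      (U : ℝ × EuclideanSpace ℝ (Fin n) → EuclideanSpace ℝ (Fin m)) hU hUc hUineq hUvan =>
    Carleman.uniqueContinuation_uncurried n m hc' hR hT (U := U) hU hUc hUineq hUvan
  have h := Carleman.backwardUniqueness_uncurried hUC he hc0 hM'0 hC2 hcont h0' hineq' hgrowth' hH3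
    (t, x) ⟨ht, hx⟩
  exact h

end Literature.Analysis.FluidPDE
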